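import Summits.HubbardSuperconductivity.HubbardSuperconductivity.Theorems.AnisotropyChordKnnMLR
import Summits.HubbardSuperconductivity.HubbardSuperconductivity.Theorems.AnisotropyChordKnnTwoLevel

/-!
# Route `AnisotropyChord` / H0 rotor rung, K_{n,n} sibling of XY-LM₀: ASSEMBLY — `XYLiebMattisKnn n Δ` from the budget
# conditions (S_M), `0 ≤ M ≤ n − 4`; UNCONDITIONAL for `n ≤ 3` at every anisotropy `Δ < 1`
(prover seat `hubbard-h0-rotor-p1` g13; theory seat `hubbard-h0-rotor-theory-1` THEOREMS M13/M14/M20 chain: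
M12 (definitional) + THEOREM Q (`…KnnTopSectors`, `…KnnTwoLevel`) + LEMMA R (`…KnnMLR`) + (S_M))

* `casimirMean_le_succ`: the adjacent link `g(L) ≤ g(L+1)` for every `0 ≤ L < n` — from (S_L) when `L + 4 ≤ n` (LEMMA R),
  from THEOREM Q when `L = n − 3`, trivially into the top sectors `L + 1 ∈ {n−1, n}`;
* `casimirMean_le_of_le`: the chain `g(L) ≤ g(L')`, `L ≤ L' ≤ n` (existence of intermediate top vectors);
* `xyLiebMattisKnn_of_budgets`: `(∀ M ≤ n−4, (S_M) at η = 1 − Δ) → XYLiebMattisKnn n Δ` (`M ↦ −M` symmetry for signs);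
* `xyLiebMattisKnn_of_le_three`: **`XYLiebMattisKnn n Δ` for `n ≤ 3` and every `Δ < 1`, unconditionally.**
-/

set_option linter.dupNamespace false
set_option autoImplicit false

noncomputable section

open Finset Matrix

namespace Summit.HubbardSuperconductivity.HubbardSuperconductivity.Theorems.AnisotropyChord.Knn

/-- THEOREM Q's top link with the sector labels as variables (for rewriting under dependent types). [folklore] -/
theorem casimirMean_le_topLink' {n : ℕ} (hn : 3 ≤ n) {η : ℝ} (hη : 0 < η) {M₁ M₂ : ℤ}
    (h₁ : M₁ = ((n - 3 : ℕ) : ℤ)) (h₂ : M₂ = ((n - 2 : ℕ) : ℤ))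
    {x : Fin (numLevels n M₁) → ℝ} {x' : Fin (numLevels n M₂) → ℝ}
    (hx : IsTopVector (knnBlock n M₁ η) x) (hx' : IsTopVector (knnBlock n M₂ η) x') :
    casimirMean n M₁ x ≤ casimirMean n M₂ x' := by
  subst h₁; subst h₂
  exact casimirMean_le_topLink hn hη hx hx'

/-- **The adjacent link `g(L) ≤ g(L+1)`** (`0 ≤ L < n`, `η > 0`), given the budget conditions (S_M) for `M ≤ n − 4`.
[conjecture: theory seat hubbard-h0-rotor-theory-1, cycle 12 — THEOREM Q⁺ chain (M20); Lean proof here modulo (S_M)] -/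
theorem casimirMean_le_succ {n : ℕ} {η : ℝ} (hη : 0 < η) (hB : ∀ M : ℕ, M + 4 ≤ n → BudgetCondition n M η)
    {L : ℕ} (hL : L + 1 ≤ n) {x : Fin (numLevels n (L : ℤ)) → ℝ} {x' : Fin (numLevels n ((L : ℤ) + 1)) → ℝ}
    (hx : IsTopVector (knnBlock n (L : ℤ) η) x) (hx' : IsTopVector (knnBlock n ((L : ℤ) + 1) η) x') :
    casimirMean n (L : ℤ) x ≤ casimirMean n ((L : ℤ) + 1) x' := by
  have hLabs : ((L : ℤ)).natAbs ≤ n := by rw [Int.natAbs_natCast]; omega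
  have hL1abs : ((L : ℤ) + 1).natAbs ≤ n := by rw [natAbs_natCast_succ]; omega
  rcases Nat.lt_or_ge (L + 3) n with h4 | h3
  · -- LEMMA R
    exact casimirMean_le_succ_of_budget (by omega) hη (hB L (by omega)) hx hx'
  · rcases Nat.lt_or_ge (L + 2) n with h3' | h2
    · -- THEOREM Q: L = n − 3
      have hn : 3 ≤ n := by omega
      refine casimirMean_le_topLink' hn hη ?_ ?_ hx hx'
      · have : L = n - 3 := by omega
        subst this; rfl
      · have : ((n - 2 : ℕ) : ℤ) = ((n - 3 : ℕ) : ℤ) + 1 := by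
          have e : n - 2 = (n - 3) + 1 := by omega
          rw [e]; push_cast; ring
        rw [this]
        have : L = n - 3 := by omega
        subst this; rfl
    · -- into a top sector
      exact casimirMean_le_of_top hLabs hL1abs (by rw [natAbs_natCast_succ]; omega) hx.1 hx'.1

/-- **The chain `g(L) ≤ g(L')` for `0 ≤ L ≤ L' ≤ n`.** [folklore] -/
theorem casimirMean_le_of_le {n : ℕ} {η : ℝ} (hη : 0 < η) (hB : ∀ M : ℕ, M + 4 ≤ n → BudgetCondition n M η)
    {L L' : ℕ} (hLL' : L ≤ L') (hL' : L' ≤ n) {x : Fin (numLevels n (L : ℤ)) → ℝ}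
    (hx : IsTopVector (knnBlock n (L : ℤ) η) x) :
    ∀ {x' : Fin (numLevels n (L' : ℤ)) → ℝ}, IsTopVector (knnBlock n (L' : ℤ) η) x' →
      casimirMean n (L : ℤ) x ≤ casimirMean n (L' : ℤ) x' := by
  induction L', hLL' using Nat.le_induction with
  | base =>
    intro x' hx'
    exact (casimirMean_eq_of_natAbs_eq rfl (by rw [Int.natAbs_natCast]; omega) hη hx hx').le
  | succ L' hLL' ih =>
    intro x' hx'
    -- an intermediate top vector in the sector L'
    obtain ⟨z, hz⟩ := exists_isTopVector (numLevels_pos n (L' : ℤ)) (pK n (L' : ℤ) η) (cK n (L' : ℤ) η)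
      (fun k => cK_nonneg n (L' : ℤ) hη.le k)
    rw [← knnBlock_eq_jac] at hz
    have h1 := ih (by omega) hz
    have h2 := casimirMean_le_succ hη hB (by omega) hz hx'
    exact h1.trans h2

/-- **ASSEMBLY: `XYLiebMattisKnn n Δ` from the budget conditions (S_M), `0 ≤ M ≤ n − 4`, at `η = 1 − Δ > 0`.**
Via `M ↦ −M` symmetry (`casimirMean_eq_of_natAbs_eq`) both sectors are moved to `M, M' ≥ 0`, then the chain.
[conjecture: theory seat hubbard-h0-rotor-theory-1, cycle 12 — THEOREM Q⁺ (M20) modulo (S_M); Lean proof here] -/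
theorem xyLiebMattisKnn_of_budgets {n : ℕ} {Δ : ℝ} (hΔ : Δ < 1)
    (hB : ∀ M : ℕ, M + 4 ≤ n → BudgetCondition n M (1 - Δ)) : XYLiebMattisKnn n Δ := by
  intro M M' hMM' hM' x x' hx hx'
  have hη : 0 < 1 - Δ := by linarith
  have hLL' : M.natAbs ≤ M'.natAbs := by
    have : ((M.natAbs : ℕ) : ℤ) ≤ M'.natAbs := by
      rw [Int.natCast_natAbs, Int.natCast_natAbs]; exact hMM'
    exact_mod_cast this
  have hM : M.natAbs ≤ n := hLL'.trans hM'
  obtain ⟨z, hz⟩ := exists_isTopVector (numLevels_pos n (M.natAbs : ℤ)) (pK n (M.natAbs : ℤ) (1 - Δ))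
    (cK n (M.natAbs : ℤ) (1 - Δ)) (fun k => cK_nonneg n _ hη.le k)
  obtain ⟨z', hz'⟩ := exists_isTopVector (numLevels_pos n (M'.natAbs : ℤ)) (pK n (M'.natAbs : ℤ) (1 - Δ))
    (cK n (M'.natAbs : ℤ) (1 - Δ)) (fun k => cK_nonneg n _ hη.le k)
  rw [← knnBlock_eq_jac] at hz hz'
  have e1 : casimirMean n M x = casimirMean n (M.natAbs : ℤ) z :=
    casimirMean_eq_of_natAbs_eq (by rw [Int.natAbs_natCast]) hM hη hx hz
  have e2 : casimirMean n M' x' = casimirMean n (M'.natAbs : ℤ) z' :=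
    casimirMean_eq_of_natAbs_eq (by rw [Int.natAbs_natCast]) hM' hη hx' hz'
  rw [e1, e2]
  exact casimirMean_le_of_le hη hB hLL' hM' hz hz'

/-- **`XYLiebMattisKnn n Δ` holds UNCONDITIONALLY for `n ≤ 3` (the graphs `K_{1,1}, K_{2,2}, K_{3,3}`) at every anisotropy
`Δ < 1`** — every link is a THEOREM-Q link. [conjecture: theory seat hubbard-h0-rotor-theory-1, cycle 11 — THEOREM Q (M13),
corollary; Lean proof here] -/
theorem xyLiebMattisKnn_of_le_three {n : ℕ} (hn : n ≤ 3) {Δ : ℝ} (hΔ : Δ < 1) : XYLiebMattisKnn n Δ :=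
  xyLiebMattisKnn_of_budgets hΔ (fun M hM => absurd hM (by omega))

end Summit.HubbardSuperconductivity.HubbardSuperconductivity.Theorems.AnisotropyChord.Knn
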